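import Summits.QuantumFields.YangMills.Theorems.BalabanUVNodesN20FinalLevelBankedBudget

/-!
# N20 (NE7b), ITEM (c): THE BIRTH-CELL COUNT DISCHARGED — the cells of age `a` are the points of a box `ℓ·L^a` per side in `ℤ^d`, EXACTLY `ℓ^d·(L^d)^a` of them, so the stock budgets of
# `…N20FinalLevelBankedBudget` hold with `V = ℓ^d`, `Λ = L^d` and NO cell-count hypothesis (R4's count; `T4PersistentHistoryCount.card_torusCells` is the `Fin`-typed twin)

Cell `pub-ymgap`, YM-PLAN Track A (HUMAN RULING D-0062); seat `pub-ymgap-dag-n20-d` (R134 (a) N20 NE7b s3), gen 40 — director-ym №374 line (E), item (c).  `--kind proof --supports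
stmt-QuantumFields-27366 --as helper` (K3⁸); COUNT-NEUTRAL; THEOREMS ONLY (0 `def`).  Companion: `…N20FinalLevelBankedBudget` (gen 40, p771116: `sum_stock_le_twoRate_of_slotPrices ∕
_of_uniformWindow ∕ _of_records` with the displayed cell count `hcell : #Cell a ≤ V·Λ^a`).

WHAT IS PROVED (kernel counting).  `card_boxCells` (`#(Fin d → range(ℓ·L^a)) = (ℓ·L^a)^d`, `Fintype.card_piFinset`), `card_boxCells_le` (the real-cast shape `≤ ℓ^d·(L^d)^a`, an equality),
★★ `sum_stock_le_twoRate_of_slotPrices_box` (p771116's slot budget with the cells := the boxes, `V = ℓ^d`, `Λ = L^d`: `Σ_{Old} x ≤ C·ℓ^d·(L^dσ)^{K − j⋆ + 1}∕(1 − L^dσ)`, NO `hcell`), ★★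
`sum_stock_le_twoRate_of_uniformWindow_box`, ★★ `sum_stock_le_twoRate_of_records_box` (the same for LINE (E)'s sentence and for print's variable windows).

HONEST FRAMING.  [bookkeeping].  That the birth cell of a pending component born at step `j` of a run of `K` steps IS a point of the scale-`j` lattice in a torus of `ℓ^d` unit blocks
(`d = 4`, `ℓ = F.side`) is READING (R4 ∕ (ID)), not proved; the letters, removal data and prices stay displayed as in the companion.  NO weight of Bałaban's is bounded; NE7b NOT PRINTED ∕
NOT proved; N20 NOT discharged; counts UNMOVED (typed 28∕28 · discharged 8∕27); one finite four-torus programme at fixed `ε` — NOT ℝ⁴, NOT OS, NOT a mass gap, NOT the Clay problem.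
No `def`, no `instance`, no `notation`, no `sorry`; no decl below carries a cite tag.
-/

open Finset

namespace YMDAG.UVSplit

open Literature.MathematicalPhysics.QuantumFieldTheory.Balaban1983to89
open T4PersistentHistoryCount (records)

/-- **THE BOX COUNT**: the functions `Fin d → ℕ` with all values `< ℓ·L^a` number exactly `(ℓ·L^a)^d`. [folklore] -/
theorem card_boxCells (d ℓ L a : ℕ) : (Fintype.piFinset fun _ : Fin d => Finset.range (ℓ * L ^ a)).card = (ℓ * L ^ a) ^ d := by
  rw [Fintype.card_piFinset, Finset.prod_const, Finset.card_range, Finset.card_univ, Fintype.card_fin]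

/-- … in the shape `#Cell a ≤ V·Λ^a` of the companion's `hcell`, with `V = ℓ^d`, `Λ = L^d` (an equality). [folklore] -/
theorem card_boxCells_le (d ℓ L a : ℕ) :
    ((Fintype.piFinset fun _ : Fin d => Finset.range (ℓ * L ^ a)).card : ℝ) ≤ ((ℓ : ℝ) ^ d) * ((L : ℝ) ^ d) ^ a := by
  rw [card_boxCells]; push_cast
  rw [mul_pow, ← pow_mul, ← pow_mul, Nat.mul_comm a d]

/-- ★★ **THE SLOT BUDGET WITH THE CELLS COUNTED**: p771116's `sum_stock_le_twoRate_of_slotPrices` with the birth cells of age `a` := the box `Fin d → range(ℓ·L^a)`: no cell-count hypothesis,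
`V = ℓ^d`, `Λ = L^d`. [bookkeeping] -/
theorem sum_stock_le_twoRate_of_slotPrices_box {X : Type*} (d ℓ L : ℕ) (Old : Finset X) (slot : X → (Σ _ : ℕ, (Fin d → ℕ))) (x : X → ℝ)
    {C σ : ℝ} (hC : 0 ≤ C) (hσ : 0 ≤ σ) (hr : ((L : ℝ) ^ d) * σ < 1) {jstar K : ℕ} (hj : jstar ≤ K) (hold : ∀ Y ∈ Old, (slot Y).1 < jstar)
    (hmem : ∀ Y ∈ Old, (slot Y).2 ∈ Fintype.piFinset fun _ : Fin d => Finset.range (ℓ * L ^ (K - (slot Y).1)))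
    (hprice : ∀ j < jstar, ∀ z ∈ (Fintype.piFinset fun _ : Fin d => Finset.range (ℓ * L ^ (K - j))), ∑ Y ∈ Old with slot Y = ⟨j, z⟩, x Y ≤ C * σ ^ (K - j)) :
    ∑ Y ∈ Old, x Y ≤ C * ((ℓ : ℝ) ^ d) * ((((L : ℝ) ^ d) * σ) ^ (K - jstar + 1) / (1 - ((L : ℝ) ^ d) * σ)) :=
  sum_stock_le_twoRate_of_slotPrices Old slot x (fun a => Fintype.piFinset fun _ : Fin d => Finset.range (ℓ * L ^ a)) (by positivity) (by positivity) hC hσ hr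
    (card_boxCells_le d ℓ L) hj hold hmem hprice

/-- ★★ **LINE (E)'s SENTENCE WITH THE CELLS COUNTED**: `sum_stock_le_twoRate_of_uniformWindow` with the box cells, `V = ℓ^d`, `Λ = L^d`. [bookkeeping] -/
theorem sum_stock_le_twoRate_of_uniformWindow_box {X R : Type*} (d ℓ L : ℕ) (Old : Finset X) (slot : X → (Σ _ : ℕ, (Fin d → ℕ))) (x : X → ℝ)
    {ρ Γ : ℝ} (hρ : 0 ≤ ρ) (hΓ : 0 ≤ Γ) (hq0 : 0 < Γ * ρ) (hq1 : Γ * ρ < 1) {N : ℕ} (hN : 0 < N) (hr : ((L : ℝ) ^ d) * (Γ * ρ) ^ ((1 : ℝ) / N) < 1)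
    {jstar K : ℕ} (hj : jstar ≤ K) (hold : ∀ Y ∈ Old, (slot Y).1 < jstar)
    (hmem : ∀ Y ∈ Old, (slot Y).2 ∈ Fintype.piFinset fun _ : Fin d => Finset.range (ℓ * L ^ (K - (slot Y).1)))
    (Rec : ℕ → (Fin d → ℕ) → Finset R) (m : ℕ → (Fin d → ℕ) → R → ℕ) (c : ℕ → (Fin d → ℕ) → R → ℝ) (m₀ : ℕ → ℕ)
    (hfile : ∀ j < jstar, ∀ z ∈ (Fintype.piFinset fun _ : Fin d => Finset.range (ℓ * L ^ (K - j))), ∑ Y ∈ Old with slot Y = ⟨j, z⟩, x Y ≤ ∑ r ∈ Rec j z, c j z r)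
    (hc : ∀ j < jstar, ∀ z ∈ (Fintype.piFinset fun _ : Fin d => Finset.range (ℓ * L ^ (K - j))), ∀ r ∈ Rec j z, c j z r ≤ ρ ^ m j z r)
    (hcount : ∀ j < jstar, ∀ z ∈ (Fintype.piFinset fun _ : Fin d => Finset.range (ℓ * L ^ (K - j))), ∀ k, (((Rec j z).filter fun r => m j z r = k).card : ℝ) ≤ Γ ^ k)
    (hm : ∀ j < jstar, ∀ z ∈ (Fintype.piFinset fun _ : Fin d => Finset.range (ℓ * L ^ (K - j))), ∀ r ∈ Rec j z, m₀ j ≤ m j z r)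
    (hwin : ∀ j < jstar, K + 1 - j ≤ N * (m₀ j + 1)) :
    ∑ Y ∈ Old, x Y ≤ (Γ * ρ)⁻¹ / (1 - Γ * ρ) * ((ℓ : ℝ) ^ d) *
      ((((L : ℝ) ^ d) * (Γ * ρ) ^ ((1 : ℝ) / N)) ^ (K - jstar + 1) / (1 - ((L : ℝ) ^ d) * (Γ * ρ) ^ ((1 : ℝ) / N))) :=
  sum_stock_le_twoRate_of_uniformWindow Old slot x (fun a => Fintype.piFinset fun _ : Fin d => Finset.range (ℓ * L ^ a)) (by positivity) (by positivity) hρ hΓ hq0 hq1 hN hr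
    (card_boxCells_le d ℓ L) hj hold hmem Rec m c m₀ hfile hc hcount hm hwin

/-- ★★ **PRINT'S VARIABLE WINDOWS WITH THE CELLS COUNTED**: `sum_stock_le_twoRate_of_records` with the box cells, `V = ℓ^d`, `Λ = L^d`. [bookkeeping] -/
theorem sum_stock_le_twoRate_of_records_box {X ε : Type*} [DecidableEq ε] (d ℓ L : ℕ) (Old : Finset X) (slot : X → (Σ _ : ℕ, (Fin d → ℕ))) (x : X → ℝ)
    (W : ε → ℕ) (step : ε → ℕ) {K : ℕ} (E Bk : ℕ → Finset ε) (hE : ∀ j, ∀ e ∈ E j, step e ∈ Ioc j K) {κ₁ ρbar ηbar : ℝ} (hκ : 0 ≤ κ₁)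
    (ρ : ε → ℝ) (hρ : ∀ j, ∀ b ∈ Bk j, 0 ≤ ρ b) (hρbar : ∀ j, ∑ b ∈ Bk j, ρ b ≤ ρbar) (η : ε → ℝ) (hη : ∀ j, ∀ e ∈ E j, 0 ≤ η e)
    (hηbar : ∀ j, ∀ t ∈ Ioc j K, ∑ e ∈ E j with step e = t, η e ≤ ηbar) (hr : ((L : ℝ) ^ d) * Real.exp (ηbar - κ₁) < 1)
    {jstar : ℕ} (hj : jstar ≤ K) (hold : ∀ Y ∈ Old, (slot Y).1 < jstar)
    (hmem : ∀ Y ∈ Old, (slot Y).2 ∈ Fintype.piFinset fun _ : Fin d => Finset.range (ℓ * L ^ (K - (slot Y).1)))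
    (y : ℕ → (Fin d → ℕ) → ε → Finset ε → ℝ)
    (hfile : ∀ j < jstar, ∀ z ∈ (Fintype.piFinset fun _ : Fin d => Finset.range (ℓ * L ^ (K - j))),
      ∑ Y ∈ Old with slot Y = ⟨j, z⟩, x Y ≤ ∑ b ∈ Bk j, ∑ Q ∈ records W j K (E j) b, y j z b Q)
    (hy : ∀ j < jstar, ∀ z ∈ (Fintype.piFinset fun _ : Fin d => Finset.range (ℓ * L ^ (K - j))), ∀ b ∈ Bk j, ∀ Q ∈ records W j K (E j) b,
      y j z b Q ≤ ρ b * Real.exp (-(κ₁ * W b)) * ∏ e ∈ Q, (Real.exp (-(κ₁ * W e)) * η e)) :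
    ∑ Y ∈ Old, x Y ≤ ρbar * Real.exp (-κ₁) * ((ℓ : ℝ) ^ d) *
      ((((L : ℝ) ^ d) * Real.exp (ηbar - κ₁)) ^ (K - jstar + 1) / (1 - ((L : ℝ) ^ d) * Real.exp (ηbar - κ₁))) :=
  sum_stock_le_twoRate_of_records Old slot x (fun a => Fintype.piFinset fun _ : Fin d => Finset.range (ℓ * L ^ a)) (by positivity) (by positivity)
    (card_boxCells_le d ℓ L) W step E Bk hE hκ ρ hρ hρbar η hη hηbar hr hj hold hmem y hfile hy

end YMDAG.UVSplit
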